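import Literature.NumberTheory.GaloisRepresentations.FrobeniusDensityTheorem
import Literature.NumberTheory.GaloisRepresentations.FrobeniusDensity
import Literature.NumberTheory.GaloisRepresentations.ArtinReciprocityCharacterProofs
import Literature.NumberTheory.LFunctions.NumberFieldDirichletDensityCalculus
import HarnessLib

/-!
# Frobenius elements over a set of places of Dirichlet density one (proofs)

Topic `Literature/NumberTheory/GaloisRepresentations`; namespace
`Literature.NumberTheory.GaloisRepresentations`.  A *proofs* file (theorems only; no definition,
no named fact).  Its purpose is to make the hypothesis "for all places `v` in a set `𝓛` of
Dirichlet density one" (Böckle–Hui 2025, Def. 2.3 of a *weak direct summand*) usable with the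
density theorems the tree has PROVED — Frobenius' theorem for cyclic extensions
(`hasStrongDirichletDensity_setOf_frobenius_generates`, `FrobeniusDensityTheorem.lean`) — in place
of Chebotarev's density theorem over a general number field (which the tree has only over `ℚ`).

* `exists_prime_absNorm_under_mem_of_hasDirichletDensity_one` (**transfer**) — for number fields
  `F ⊆ M`, a set `X` of primes of `M` of strong Dirichlet density `c > 0` and a set `𝓛` of primes
  of `F` of Dirichlet density one, some `𝔮 ∈ X` of prime absolute norm lies over a place of `𝓛`
  (indeed: otherwise `Σ_{𝔮 ∈ X, N𝔮 prime} N𝔮^{-s} ≤ 2^{[M:ℚ]} Σ_{v ∉ 𝓛} Nv^{-s} = o(log 1/(s-1))`,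
  contradicting `c > 0`).
* `FramedGaloisRep.exists_mem_frobenius_mem_division_of_hasDirichletDensity_one` (**Frobenius'
  division theorem along a density-one set**) — for `σ : Γ_F → GL_n(A)` with open kernel, `g ∈ Γ_F`
  and `𝓛` of density one, some `v ∈ 𝓛` (with `σ` unramified at `v`) carries an arithmetic
  Frobenius `Φ` with `σ(Φ) = σ(g)^k`, `(k, ord σ(g)) = 1` (the tree's
  `FramedGaloisRep.infinite_setOf_frobenius_mem_division` with the transfer step).
* `absoluteGaloisGroup.eq_univ_of_frobenius_mem_of_hasDirichletDensity_one` (**density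
  criterion**) — a CLOSED subset `Z ⊆ Γ_K` stable under positive powers which contains all
  arithmetic Frobenii over a density-one set of places is all of `Γ_K` (Krull density criterion +
  faithful Artin representations of the finite quotients + the previous theorem + `k j ≡ 1`).
  This substitutes for Chebotarev's density theorem in Böckle–Hui's Prop. 2.4 for characters.
* `MonoidHom.eq_one_of_frobenius_eq_one_of_hasDirichletDensity_one`,
  `FramedGaloisRep.eq_of_frobenius_eq_of_hasDirichletDensity_one` (appended) — **rigidity along a
  density-one set**: a continuous homomorphism of `Γ_K` into a `T₁` group killing all Frobenii over
  a density-one set of places is trivial; two continuous representations `Γ_K → GL_n(A)` (`A`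
  Hausdorff) agreeing at all Frobenii over a density-one set are equal.  In Böckle–Hui this is the
  step "`δ(S_{𝟙∣ν}) = 1` and thus `𝟙 = ν` by the Chebotarev density theorem" (Lemma 2.8 (iv),
  Prop. 2.9: "`1/ord(ψ_i ξ_a⁻¹) = … = 1` and we must have `ψ_i = ξ_a`").

## References

* G. Frobenius, *Über Beziehungen zwischen den Primidealen eines algebraischen Körpers und den
  Substitutionen seiner Gruppe*, S.-B. Berlin 1896; D. Marcus, *Number Fields*, Ch. 7, Ex. 10–12.
  [Marcus2018]
* J. Neukirch, *Algebraic Number Theory* (1999), VII §13. [NeukirchANT1999]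
* G. Böckle, C.-Y. Hui, Math. Ann. 393 (2025), Def. 2.3, Prop. 2.4. [BockleHui2025]
-/

noncomputable section

open NumberField IsDedekindDomain Filter Topology
open scoped Classical

namespace Literature.NumberTheory.GaloisRepresentations

open Literature.NumberTheory.LFunctions Literature.NumberTheory.LFunctions.NumberField

/-! ### Transfer: a positive-density set of primes of `M` meets the fibres over a density-one
set of places of `F ⊆ M` -/

section Transfer

variable {F : Type*} [Field F] [NumberField F] {M : Type*} [Field M] [NumberField M] [Algebra F M]

/-- **A prime series dominated coefficientwise is dominated.**  For coefficient functions
`f, g` on the primes with `|f|, |g|` bounded and `f p ≤ g p` for all primes `p`,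
`Σ_p f(p) p^{-s} ≤ Σ_p g(p) p^{-s}` for `s > 1`. [folklore] -/
theorem primeSeries_mono {f g : ℕ → ℝ} {Bf Bg : ℝ} (hf : ∀ p : Nat.Primes, |f p| ≤ Bf)
    (hg : ∀ p : Nat.Primes, |g p| ≤ Bg) (hfg : ∀ p : Nat.Primes, f p ≤ g p) {s : ℝ} (hs : 1 < s) :
    primeSeries f s ≤ primeSeries g s := by
  rw [primeSeries_def, primeSeries_def]
  exact (summable_primes_mul_rpow_of_bounded hf hs).tsum_le_tsum
    (fun p => mul_le_mul_of_nonneg_right (hfg p) (Real.rpow_nonneg (Nat.cast_nonneg _) _))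
    (summable_primes_mul_rpow_of_bounded hg hs)

/-- **Counting step.**  If every prime `𝔮 ∈ X` of prime absolute norm lies over a place of `Z`,
then for every prime `p`, `#{𝔮 ∈ X : N𝔮 = p} ≤ 2^{[M:ℚ]} · #{v ∈ Z : Nv = p}`: either the left
side is `0`, or some `𝔮 ∈ X` has `N𝔮 = p`, its place `v = 𝔮 ∩ F` below has `Nv = p`
(`inertiaDeg_eq_one_of_prime_absNorm`) and lies in `Z`, so the right count is `≥ 1`, while the
left count is `≤ 2^{[M:ℚ]}` (`abs_primeNormCount_le`). [folklore] -/
theorem primeNormCount_le_mul_primeNormCount_of_forall_under_mem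
    {X : Set (HeightOneSpectrum (𝓞 M))} {Z : Set (HeightOneSpectrum (𝓞 F))}
    (H : ∀ q ∈ X, (Ideal.absNorm q.asIdeal).Prime → q.under (𝓞 F) ∈ Z) (p : Nat.Primes) :
    (primeNormCount M X p : ℝ) ≤
      (2 : ℝ) ^ Module.finrank ℚ M * (primeNormCount F Z p : ℝ) := by
  by_cases h0 : primeNormCount M X p = 0
  · rw [h0, Nat.cast_zero]
    exact mul_nonneg (pow_nonneg zero_le_two _) (Nat.cast_nonneg _)
  · -- a prime `q ∈ X` of norm `p`
    obtain ⟨q, hq⟩ : ((primesOfNorm M p).filter (· ∈ X)).Nonempty :=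
      Finset.card_pos.mp (Nat.pos_of_ne_zero h0)
    rw [Finset.mem_filter, mem_primesOfNorm] at hq
    obtain ⟨hqN, hqX⟩ := hq
    have hqprime : (Ideal.absNorm q.asIdeal).Prime := hqN ▸ p.prop
    -- the place below has norm `p` and lies in `Z`, so the right count is positive
    have h1 : (1 : ℝ) ≤ primeNormCount F Z p := by
      have hpos : 0 < primeNormCount F Z p := by
        rw [primeNormCount]
        refine Finset.card_pos.mpr ⟨q.under (𝓞 F), ?_⟩
        rw [Finset.mem_filter, mem_primesOfNorm]
        exact ⟨(inertiaDeg_eq_one_of_prime_absNorm (M := F) q hqprime).2.trans hqN,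
          H q hqX hqprime⟩
      exact Nat.one_le_cast.mpr hpos
    calc (primeNormCount M X p : ℝ) ≤ (2 : ℝ) ^ Module.finrank ℚ M := by
          have := abs_primeNormCount_le X p
          rwa [abs_of_nonneg (Nat.cast_nonneg _)] at this
      _ = (2 : ℝ) ^ Module.finrank ℚ M * 1 := (mul_one _).symm
      _ ≤ (2 : ℝ) ^ Module.finrank ℚ M * (primeNormCount F Z p : ℝ) :=
          mul_le_mul_of_nonneg_left h1 (pow_nonneg zero_le_two _)

/-- **The degree-one series of a set of strong density `c` is `c · log (1/(s-1)) + O(1)`**, in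
quotient form: `(Σ_{𝔮 ∈ X, N𝔮 prime} N𝔮^{-s}) / log (1/(s-1)) → c` as `s → 1⁺`. [folklore] -/
theorem tendsto_tsum_prime_absNorm_div_log {X : Set (HeightOneSpectrum (𝓞 M))} {c : ℝ}
    (hX : HasStrongDirichletDensity M X c) :
    Tendsto (fun s : ℝ => (∑' q : HeightOneSpectrum (𝓞 M),
        if q ∈ X ∧ (Ideal.absNorm q.asIdeal).Prime then (Ideal.absNorm q.asIdeal : ℝ) ^ (-s)
        else 0) / Real.log (1 / (s - 1))) (𝓝[>] (1 : ℝ)) (𝓝 c) := by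
  obtain ⟨L, hL⟩ := hX
  have hℓ := PrimeSum.tendsto_log_one_div_sub_one
  have h1 : Tendsto (fun s : ℝ => (primeSeries (fun p => (primeNormCount M X p : ℝ)) s +
      c * Real.log (s - 1)) / Real.log (1 / (s - 1))) (𝓝[>] (1 : ℝ)) (𝓝 0) := hL.div_atTop hℓ
  have h2 := h1.add_const c
  rw [zero_add] at h2
  refine h2.congr' ?_
  filter_upwards [PrimeSum.eventually_log_pos, PrimeSum.eventually_one_lt] with s hlog hs
  rw [tsum_prime_absNorm_eq_primeSeries X hs]
  have hM : Real.log (1 / (s - 1)) = -Real.log (s - 1) := by rw [one_div, Real.log_inv]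
  rw [hM] at hlog ⊢
  have hne : Real.log (s - 1) ≠ 0 := by
    intro h0
    rw [h0, neg_zero] at hlog
    exact lt_irrefl _ hlog
  field_simp
  ring

/-- **A set of places of Dirichlet density zero has `Σ_{v ∈ Z} Nv^{-s} = o(log (1/(s-1)))`.**
[folklore] -/
theorem tendsto_tsum_indicator_div_log_zero {Z : Set (HeightOneSpectrum (𝓞 F))}
    (hZ : HasDirichletDensity F Z 0) :
    Tendsto (fun s : ℝ => (∑' v : HeightOneSpectrum (𝓞 F),
        if v ∈ Z then (Ideal.absNorm v.asIdeal : ℝ) ^ (-s) else 0) / Real.log (1 / (s - 1)))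
      (𝓝[>] (1 : ℝ)) (𝓝 0) := by
  have hU := tendsto_tsum_indicator_absNorm_div_log (hasStrongDirichletDensity_univ F)
  simp only [Set.mem_univ, if_true] at hU
  have h := hZ.mul hU
  rw [zero_mul] at h
  refine h.congr' ?_
  filter_upwards [PrimeSum.eventually_one_lt] with s hs
  rw [div_mul_div_comm, mul_comm _ (Real.log (1 / (s - 1))),
    mul_div_mul_right _ _ (tsum_absNorm_rpow_neg_pos hs).ne']

/-- **Transfer along a finite extension (density-zero form).**  Let `F ⊆ M` be number fields,
`X` a set of primes of `M` of strong Dirichlet density `c > 0` and `Z` a set of finite places of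
`F` of Dirichlet density zero.  Then some `𝔮 ∈ X` of prime absolute norm lies over a place
`𝔮 ∩ F ∉ Z`.  Proof: otherwise `Σ_{𝔮 ∈ X, N𝔮 prime} N𝔮^{-s} ≤ 2^{[M:ℚ]} Σ_{v ∈ Z} Nv^{-s}`
(`primeNormCount_le_mul_primeNormCount_of_forall_under_mem`, summed), and dividing by
`log (1/(s-1))` gives `c ≤ 2^{[M:ℚ]} · 0` in the limit `s → 1⁺`.  (This is the step "the primes
of degree one over `F` carry the density", Neukirch VII (13.4), proof, p. 545, in the form needed
to meet a prescribed large set downstairs.) [cite: NeukirchANT1999, VII (13.4), proof (p. 545)] -/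
theorem exists_prime_absNorm_under_not_mem_of_hasDirichletDensity_zero
    {X : Set (HeightOneSpectrum (𝓞 M))} {c : ℝ} (hX : HasStrongDirichletDensity M X c)
    (hc : 0 < c) {Z : Set (HeightOneSpectrum (𝓞 F))} (hZ : HasDirichletDensity F Z 0) :
    ∃ q ∈ X, (Ideal.absNorm q.asIdeal).Prime ∧ q.under (𝓞 F) ∉ Z := by
  by_contra H
  push Not at H
  set d : ℝ := (2 : ℝ) ^ Module.finrank ℚ M with hd
  have hd0 : 0 ≤ d := pow_nonneg zero_le_two _
  -- the two limits
  have hA := tendsto_tsum_prime_absNorm_div_log hX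
  have hB := (tendsto_tsum_indicator_div_log_zero hZ).const_mul d
  rw [mul_zero] at hB
  -- the comparison, for `s > 1`
  have hAB : ∀ s : ℝ, 1 < s →
      (∑' q : HeightOneSpectrum (𝓞 M),
        if q ∈ X ∧ (Ideal.absNorm q.asIdeal).Prime then (Ideal.absNorm q.asIdeal : ℝ) ^ (-s)
        else 0) ≤
      d * ∑' v : HeightOneSpectrum (𝓞 F),
        if v ∈ Z then (Ideal.absNorm v.asIdeal : ℝ) ^ (-s) else 0 := by
    intro s hs
    rw [tsum_prime_absNorm_eq_primeSeries X hs]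
    calc primeSeries (fun p => (primeNormCount M X p : ℝ)) s
        ≤ primeSeries (fun p => d * (primeNormCount F Z p : ℝ)) s := by
          refine primeSeries_mono (abs_primeNormCount_le X)
            (Bg := d * (2 : ℝ) ^ Module.finrank ℚ F) (fun p => ?_)
            (fun p => primeNormCount_le_mul_primeNormCount_of_forall_under_mem H p) hs
          rw [abs_mul, abs_of_nonneg hd0]
          exact mul_le_mul_of_nonneg_left (abs_primeNormCount_le _ p) hd0
      _ = d * primeSeries (fun p => (primeNormCount F Z p : ℝ)) s := by
          rw [primeSeries_def, primeSeries_def, ← tsum_mul_left]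
          exact tsum_congr fun p => by ring
      _ ≤ d * ∑' v : HeightOneSpectrum (𝓞 F),
            if v ∈ Z then (Ideal.absNorm v.asIdeal : ℝ) ^ (-s) else 0 := by
          refine mul_le_mul_of_nonneg_left ?_ hd0
          rw [← tsum_prime_absNorm_eq_primeSeries Z hs]
          refine (summable_indicator_absNorm_rpow_neg _ hs).tsum_le_tsum (fun v => ?_)
            (summable_indicator_absNorm_rpow_neg _ hs)
          split_ifs with h1 h2 h2
          · exact le_rfl
          · exact absurd h1.1 h2
          · exact absNorm_rpow_neg_nonneg v s
          · exact le_rfl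
  -- pass to the limit
  have hle : c ≤ 0 := by
    refine le_of_tendsto_of_tendsto hA hB ?_
    filter_upwards [PrimeSum.eventually_log_pos, PrimeSum.eventually_one_lt] with s hlog hs
    have h := div_le_div_of_nonneg_right (hAB s hs) hlog.le
    rwa [mul_div_assoc] at h
  exact absurd hle (not_le.mpr hc)

/-- **Transfer of density one along a finite extension.**  Let `F ⊆ M` be number fields, `X` a
set of primes of `M` of strong Dirichlet density `c > 0` and `𝓛` a set of finite places of `F` of
Dirichlet density one.  Then some `𝔮 ∈ X` of prime absolute norm lies over a place `𝔮 ∩ F ∈ 𝓛`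
(`exists_prime_absNorm_under_not_mem_of_hasDirichletDensity_zero` for `Z = 𝓛ᶜ`, of density
`1 - 1 = 0`). [cite: NeukirchANT1999, VII (13.4), proof (p. 545)] -/
theorem exists_prime_absNorm_under_mem_of_hasDirichletDensity_one
    {X : Set (HeightOneSpectrum (𝓞 M))} {c : ℝ} (hX : HasStrongDirichletDensity M X c)
    (hc : 0 < c) {𝓛 : Set (HeightOneSpectrum (𝓞 F))} (h𝓛 : HasDirichletDensity F 𝓛 1) :
    ∃ q ∈ X, (Ideal.absNorm q.asIdeal).Prime ∧ q.under (𝓞 F) ∈ 𝓛 := by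
  have hZ : HasDirichletDensity F 𝓛ᶜ 0 := by
    have := h𝓛.compl
    rwa [sub_self] at this
  obtain ⟨q, hqX, hqp, hq⟩ :=
    exists_prime_absNorm_under_not_mem_of_hasDirichletDensity_zero hX hc hZ
  exact ⟨q, hqX, hqp, Set.notMem_compl_iff.mp hq⟩

end Transfer

/-! ### Frobenius' division theorem over a set of places of density one -/

section Absolute

open Field

variable {F : Type*} [Field F] [NumberField F] {A : Type*} [CommRing A] [TopologicalSpace A]
  {n : ℕ}

/-- **Frobenius' division theorem along a set of places of density one.**  Let
`σ : Γ_F → GL_n(A)` have open kernel (e.g. an Artin representation), `g ∈ Γ_F`, and let `𝓛` be a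
set of finite places of `F` of Dirichlet density one (Neukirch VII (13.1)).  Then SOME place
`v ∈ 𝓛` at which `σ` is unramified admits an arithmetic Frobenius `Φ` (at a prime of `\bar ℤ_F`
above `v`) with `σ(Φ) = σ(g)^k` for some `k` prime to the order of `σ(g)` — i.e. the Frobenius
class of `v` lies in the *division* of `σ(g)`.  This is the tree's
`FramedGaloisRep.infinite_setOf_frobenius_mem_division` (Frobenius 1896; Marcus, *Number Fields*,
Ch. 7, Ex. 12 (f)) with "infinitely many `v`" sharpened to "some `v` in any set of density one":
its proof is followed verbatim — in `L = F̄^{ker σ}` let `M` be the fixed field of `⟨g|_L⟩`; by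
Frobenius' theorem for the cyclic extension `L/M`
(`hasStrongDirichletDensity_setOf_frobenius_generates`) the primes `q` of `M` whose Frobenius
generates `Gal(L/M) = ⟨g|_L⟩` have positive strong density —
the one new step being the TRANSFER `exists_prime_absNorm_under_mem_of_hasDirichletDensity_one`:
such a `q` of prime absolute norm can be found over a place of `𝓛` avoiding the finitely many
places where `σ` or `L/F` ramify (`HasDirichletDensity.diff_of_finite`); for it the Frobenius of
`L/F` at a prime `Q ∣ q` is the same element (`N q = N v`), and any Frobenius `Φ ∈ Γ_F` above `Q`
restricts to it, whence `σ(Φ) = σ(g^k)`.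
[cite: Marcus2018, Ch. 7, Exercise 12 (f)] [cite: NeukirchANT1999, VII (13.4), proof (p. 545)] -/
theorem FramedGaloisRep.exists_mem_frobenius_mem_division_of_hasDirichletDensity_one
    (σ : FramedGaloisRep F A n) (hker : IsOpen (σ.toMonoidHom.ker : Set (absoluteGaloisGroup F)))
    (g : absoluteGaloisGroup F) {𝓛 : Set (HeightOneSpectrum (𝓞 F))}
    (h𝓛 : HasDirichletDensity F 𝓛 1) :
    ∃ v ∈ 𝓛, σ.IsUnramifiedAt v ∧ ∃ 𝔓 ∈ v.primesAbove,
      ∃ Φ : absoluteGaloisGroup F, IsArithFrobAt (𝓞 F) Φ 𝔓 ∧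
        ∃ k : ℕ, k.Coprime (orderOf (σ g)) ∧ σ Φ = σ g ^ k := by
  classical
  -- Step 0: the finite Galois extension `L = F̄^{ker σ}` and the restriction `r : Γ_F → Gal(L/F)`
  set N : Subgroup (absoluteGaloisGroup F) := σ.toMonoidHom.ker with hNdef
  set L : IntermediateField F (AlgebraicClosure F) := IntermediateField.fixedField N with hLdef
  have hLN : L.fixingSubgroup = N := fixingSubgroup_fixedField_of_isOpen N hker
  haveI : FiniteDimensional F L := finiteDimensional_fixedField_of_isOpen N hker
  haveI : IsGalois F L := by
    rw [← InfiniteGalois.normal_iff_isGalois, hLN, hNdef]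
    exact MonoidHom.normal_ker _
  haveI : NumberField L := NumberField.of_module_finite F L
  set r : absoluteGaloisGroup F →* (L ≃ₐ[F] L) :=
    (AlgEquiv.restrictNormalHom L).comp (absoluteGaloisGroup.toAlgEquiv F).toMonoidHom with hrdef
  have hr : ∀ (γ : absoluteGaloisGroup F) (x : L),
      ((r γ x : L) : AlgebraicClosure F) = γ • (x : AlgebraicClosure F) :=
    fun γ x => AlgEquiv.restrictNormalHom_apply L _ x
  have hmemN : ∀ γ : absoluteGaloisGroup F, γ ∈ N ↔ σ γ = 1 := fun γ => MonoidHom.mem_ker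
  have hrker : ∀ γ : absoluteGaloisGroup F, r γ = 1 ↔ σ γ = 1 := by
    intro γ
    have key : r γ = 1 ↔ γ ∈ (L.fixingSubgroup : Subgroup (absoluteGaloisGroup F)) := by
      rw [mem_fixingSubgroup_iff_forall_smul]
      constructor
      · intro h x
        rw [← hr γ x, h, AlgEquiv.one_apply]
      · intro h
        ext x
        rw [hr γ x, AlgEquiv.one_apply]
        exact h x
    rw [key, hLN]
    exact hmemN γ
  -- Step 1: `ḡ = g|_L`, the cyclic subgroup `H = ⟨ḡ⟩`, its fixed field `M`, `Gal(L/M) = ⟨ĝ⟩`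
  set gb : L ≃ₐ[F] L := r g with hgbdef
  set H : Subgroup (L ≃ₐ[F] L) := Subgroup.zpowers gb with hHdef
  set M : IntermediateField F L := IntermediateField.fixedField H with hMdef
  have hMH : M.fixingSubgroup = H := IntermediateField.fixingSubgroup_fixedField H
  haveI : NumberField M := NumberField.of_module_finite F M
  set e : M.fixingSubgroup ≃* (L ≃ₐ[M] L) := IntermediateField.fixingSubgroupEquiv M with hedef
  have hgbH : gb ∈ M.fixingSubgroup := by rw [hMH]; exact Subgroup.mem_zpowers gb
  set gh : L ≃ₐ[M] L := e ⟨gb, hgbH⟩ with hghdef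
  have hegh : e.symm gh = ⟨gb, hgbH⟩ := by rw [hghdef, e.symm_apply_apply]
  have hres : ∀ ψ : L ≃ₐ[M] L, ((e.symm ψ : M.fixingSubgroup) : L ≃ₐ[F] L) = ψ.restrictScalars F :=
    fun ψ => rfl
  have hgh : ∀ x : L ≃ₐ[M] L, x ∈ Subgroup.zpowers gh := by
    intro x
    have hx : ((e.symm x : M.fixingSubgroup) : L ≃ₐ[F] L) ∈ H := hMH ▸ (e.symm x).2
    obtain ⟨i, hi⟩ := Subgroup.mem_zpowers_iff.mp hx
    refine ⟨i, ?_⟩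
    apply e.symm.injective
    change e.symm (gh ^ i) = e.symm x
    rw [map_zpow, hegh]
    exact Subtype.ext (by rw [SubgroupClass.coe_zpow]; exact hi)
  have hpow_res : ∀ k : ℕ, (gh ^ k).restrictScalars F = gb ^ k := by
    intro k
    rw [← hres, map_pow, hegh, SubgroupClass.coe_pow]
  -- orders: `ord ĝ = ord ḡ = ord σ(g)`
  have hord1 : orderOf gh = orderOf gb := by
    have h1 : orderOf (e.symm gh) = orderOf gh :=
      orderOf_injective e.symm.toMonoidHom e.symm.injective gh
    rw [← h1, hegh, ← Subgroup.orderOf_coe]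
  have hord2 : orderOf gb = orderOf (σ g) := by
    rw [orderOf_eq_orderOf_iff]
    intro k
    rw [hgbdef, ← map_pow, hrker, map_pow]
  -- Step 2: Frobenius' theorem for the cyclic extension `L/M`
  have hdens := hasStrongDirichletDensity_setOf_frobenius_generates (M := M) (L := L) gh hgh
  have hm0 : 0 < orderOf gh := (isOfFinOrder_of_finite gh).orderOf_pos
  have hpos : (0 : ℝ) < (Nat.totient (orderOf gh) : ℝ) / orderOf gh :=
    div_pos (Nat.cast_pos.mpr (Nat.totient_pos.mpr hm0)) (Nat.cast_pos.mpr hm0)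
  -- Step 3: discard the finitely many bad places of `F`; `𝓛` minus them still has density one
  set BadF : Set (HeightOneSpectrum (𝓞 F)) :=
    {v | ¬ σ.IsUnramifiedAt v} ∪ {v | ¬ Algebra.IsUnramifiedIn (𝓞 L) v.asIdeal} with hBadF
  have hBadFfin : BadF.Finite := by
    refine Set.Finite.union ?_ (finite_setOf_not_isUnramifiedIn F L)
    have h := σ.eventually_isUnramifiedAt_of_isOpen_ker hker
    rwa [Filter.eventually_cofinite] at h
  have h𝓛' : HasDirichletDensity F (𝓛 \ BadF) 1 := h𝓛.diff_of_finite hBadFfin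
  -- Step 4: transfer — a degree-one prime `q` of `M` with generating Frobenius in `Gal(L/M)`
  -- over a good place `v = q ∩ F ∈ 𝓛`
  obtain ⟨q, ⟨hunrML, hgen⟩, hqprime, hq𝓛⟩ :=
    exists_prime_absNorm_under_mem_of_hasDirichletDensity_one hdens hpos h𝓛'
  obtain ⟨hv𝓛, hvbad⟩ := hq𝓛
  simp only [hBadF, Set.mem_setOf_eq, Set.mem_union, not_or, not_not] at hvbad
  obtain ⟨hunrσ, hunrL⟩ := hvbad
  -- a prime `Q` of `L` above `q`, its Frobenius over `M`, a generator of `Gal(L/M)`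
  haveI := q.isMaximal
  obtain ⟨Q, hQmax, hQover⟩ :=
    Ideal.exists_maximal_ideal_liesOver_of_isIntegral (S := 𝓞 L) q.asIdeal
  haveI := hQmax.isPrime
  haveI := hQover
  have hQ : Q ∈ q.asIdeal.primesOver (𝓞 L) := ⟨hQmax.isPrime, hQover⟩
  have hQne : Q ≠ ⊥ := Ideal.ne_bot_of_mem_primesOver q.ne_bot hQ
  obtain ⟨φM, hφM⟩ := exists_isArithFrobAt_ringOfIntegers (M := M) Q hQne
  have hgenφ : Subgroup.zpowers φM = ⊤ := hgen Q hQ φM hφM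
  obtain ⟨k, hk⟩ : ∃ k : ℕ, gh ^ k = φM := mem_powers_iff_mem_zpowers.mpr (hgh φM)
  -- `k` is prime to the order
  have hcop : k.Coprime (orderOf (σ g)) := by
    rw [← hord2, ← hord1]
    have hcardM : Nat.card (L ≃ₐ[M] L) = orderOf gh := by
      rw [← Subgroup.card_top, ← (Subgroup.eq_top_iff' _).mpr hgh, Nat.card_zpowers]
    have h1 : orderOf (gh ^ k) = orderOf gh := by
      rw [hk, ← hcardM]
      exact (zpowers_eq_top_iff_orderOf_eq_card φM).mp hgenφ
    rcases Nat.eq_zero_or_pos k with hk0 | hk0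
    · rw [hk0, pow_zero, orderOf_one] at h1
      rw [hk0, ← h1]
      exact Nat.coprime_one_right 0
    · rw [orderOf_pow' gh hk0.ne'] at h1
      have h2 := (Nat.div_eq_self.mp h1).resolve_left hm0.ne'
      exact Nat.Coprime.symm h2
  -- degree one: `N q = N v`
  obtain ⟨-, hNv⟩ := inertiaDeg_eq_one_of_prime_absNorm (M := F) q hqprime
  -- `Q` lies over `v = q ∩ F`
  have hQv : Q ∈ (q.under (𝓞 F)).asIdeal.primesOver (𝓞 L) := by
    refine ⟨hQmax.isPrime, ⟨?_⟩⟩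
    change (q.asIdeal).under (𝓞 F) = Q.under (𝓞 F)
    rw [hQover.over, Ideal.under_under]
  have hcardq : Nat.card (𝓞 M ⧸ Q.under (𝓞 M)) = Ideal.absNorm q.asIdeal := by
    rw [← hQover.over, ← Submodule.cardQuot_apply, ← Ideal.absNorm_apply]
  have hcardv : Nat.card (𝓞 F ⧸ Q.under (𝓞 F)) = Ideal.absNorm q.asIdeal := by
    rw [← hQv.2.over, ← hNv, ← Submodule.cardQuot_apply, ← Ideal.absNorm_apply]
  -- the Frobenius over `F` at `Q` is `φM` restricted, `= ḡ^k`
  have hφF : IsArithFrobAt (𝓞 F) (φM.restrictScalars F) Q := by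
    intro x
    have h1 := hφM x
    rw [hcardq, MulSemiringAction.toAlgHom_apply] at h1
    rw [hcardv, MulSemiringAction.toAlgHom_apply, RingOfIntegers.restrictScalars_smul]
    exact h1
  have hφF' : φM.restrictScalars F = gb ^ k := by rw [← hk, hpow_res]
  -- Step 5: a prime `𝔓` of `\bar ℤ_F` above `Q` and a Frobenius `Φ ∈ Γ_F` there
  set ι := EllipticCurves.ringOfIntegersToIntegralClosure (k := F) (Ω := AlgebraicClosure F) L
    with hιdef
  have hιalg : ∀ x : 𝓞 F, ι (algebraMap (𝓞 F) (𝓞 L) x) =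
      algebraMap (𝓞 F) (absIntegers (𝓞 F) F) x := fun x => rfl
  obtain ⟨𝔓, h𝔓prime, h𝔓Q⟩ : ∃ 𝔓 : Ideal (absIntegers (𝓞 F) F), 𝔓.IsPrime ∧ 𝔓.comap ι = Q := by
    letI : Algebra (𝓞 L) (absIntegers (𝓞 F) F) := ι.toAlgebra
    haveI : IsScalarTower (𝓞 F) (𝓞 L) (absIntegers (𝓞 F) F) :=
      IsScalarTower.of_algebraMap_eq fun x => (hιalg x).symm
    haveI : Algebra.IsIntegral (𝓞 L) (absIntegers (𝓞 F) F) :=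
      ⟨fun x => (Algebra.IsIntegral.isIntegral (R := 𝓞 F) x).tower_top⟩
    obtain ⟨𝔓, -, h𝔓prime, h𝔓Q⟩ := Ideal.exists_ideal_over_prime_of_isIntegral Q
      (⊥ : Ideal (absIntegers (𝓞 F) F))
      (fun x hx => by
        rw [Ideal.mem_comap, Ideal.mem_bot] at hx
        have hx0 : x = 0 :=
          EllipticCurves.ringOfIntegersToIntegralClosure_injective L (hx.trans (map_zero _).symm)
        rw [hx0]
        exact Q.zero_mem)
    exact ⟨𝔓, h𝔓prime, h𝔓Q⟩
  haveI := h𝔓prime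
  have h𝔓v : 𝔓 ∈ (q.under (𝓞 F)).primesAbove := by
    refine ⟨h𝔓prime, ⟨?_⟩⟩
    rw [hQv.2.over, ← h𝔓Q]
    ext x
    simp only [Ideal.under, Ideal.mem_comap]
    exact Iff.of_eq (congrArg (· ∈ 𝔓) (hιalg x))
  obtain ⟨Φ, hΦ⟩ := HeightOneSpectrum.exists_isArithFrobAt_of_mem_primesAbove_holds h𝔓v
  -- `r Φ` is a Frobenius of `L/F` at `Q = 𝔓 ∩ 𝓞 L`
  have hrΦ : IsArithFrobAt (𝓞 F) (r Φ) Q := by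
    intro y
    rw [MulSemiringAction.toAlgHom_apply]
    have h1 : ι (r Φ • y) = Φ • ι y := by
      apply Subtype.ext
      rw [integralClosure.coe_smul, EllipticCurves.coe_ringOfIntegersToIntegralClosure,
        EllipticCurves.coe_ringOfIntegersToIntegralClosure]
      exact hr Φ y
    have h3 : 𝔓.under (𝓞 F) = Q.under (𝓞 F) := by rw [← h𝔓v.2.over, ← hQv.2.over]
    have h2 := hΦ (ι y)
    rw [MulSemiringAction.toAlgHom_apply, h3] at h2
    have h4 : ι (r Φ • y - y ^ Nat.card (𝓞 F ⧸ Q.under (𝓞 F))) ∈ 𝔓 := by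
      rw [map_sub ι, map_pow ι, h1]
      exact h2
    have h5 : r Φ • y - y ^ Nat.card (𝓞 F ⧸ Q.under (𝓞 F)) ∈ 𝔓.comap ι :=
      Ideal.mem_comap.mpr h4
    rwa [h𝔓Q] at h5
  -- uniqueness of Frobenius at `Q` (`v` unramified in `L`): `r Φ = ḡ^k = r (g^k)`
  have heq : r Φ = r (g ^ k) := by
    rw [map_pow]
    change r Φ = gb ^ k
    rw [← hφF']
    exact eq_of_isArithFrobAt_of_isUnramifiedIn hunrL hQv hrΦ hφF
  have hσ : σ Φ = σ g ^ k := by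
    have h1 : r (Φ * (g ^ k)⁻¹) = 1 := by rw [map_mul, map_inv, heq, mul_inv_cancel]
    have h2 := (hrker _).mp h1
    rw [map_mul, map_inv, mul_inv_eq_one, map_pow] at h2
    exact h2
  exact ⟨q.under (𝓞 F), hv𝓛, hunrσ, 𝔓, h𝔓v, Φ, hΦ, k, hcop, hσ⟩


end Absolute

/-! ### A closed, power-stable set containing the Frobenii over a density-one set is everything -/

section Criterion

open Field

variable {K : Type} [Field K] [NumberField K]

/-- Elements of the image of a representation with open kernel have finite order (the kernel has
finite index in the compact group `Γ_K`). [folklore] -/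
theorem FramedGaloisRep.isOfFinOrder_apply_of_isOpen_ker {A : Type*} [CommRing A]
    [TopologicalSpace A] {n : ℕ} (ρ : FramedGaloisRep K A n)
    (hker : IsOpen (ρ.toMonoidHom.ker : Set (absoluteGaloisGroup K))) (g : absoluteGaloisGroup K) :
    IsOfFinOrder (ρ g) := by
  haveI : Finite (absoluteGaloisGroup K ⧸ ρ.toMonoidHom.ker) :=
    Subgroup.quotient_finite_of_isOpen _ hker
  haveI : Finite ρ.toMonoidHom.range :=
    Finite.of_equiv _ (QuotientGroup.quotientKerEquivRange ρ.toMonoidHom).toEquiv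
  exact ρ.toMonoidHom.range.subtype.isOfFinOrder
    (isOfFinOrder_of_finite (⟨ρ g, g, rfl⟩ : ρ.toMonoidHom.range))

/-- **Density criterion along a density-one set of places.**  Let `Z ⊆ Γ_K` be CLOSED and stable
under positive powers (`σ ∈ Z ⇒ σᵏ ∈ Z`, `k ≥ 1`), and suppose `Z` contains every arithmetic
Frobenius element at every prime of `\bar ℤ_K` above every place `v` of a set `𝓛` of Dirichlet
density one.  Then `Z = Γ_K`.  Proof: by the Krull density criterion
(`AlgEquiv.dense_of_forall_exists_mem_fixingSubgroup`) it suffices, given `g ∈ Γ_K` and a finite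
Galois `E/K`, to find `z ∈ Z` with `z|_E = g|_E`.  Take a faithful Artin representation `ρ` of
`Gal(E/K)` (`absoluteGaloisGroup.exists_framedArtinRep_restrictNormalHom_eq`); by Frobenius'
division theorem along `𝓛` (`exists_mem_frobenius_mem_division_of_hasDirichletDensity_one`) some
Frobenius `Φ ∈ Z` over a place of `𝓛` has `ρ(Φ) = ρ(g)ᵏ` with `(k, ord ρ(g)) = 1`; with
`k j ≡ 1 (mod ord ρ(g))` the power `z = Φʲ ∈ Z` has `ρ(z) = ρ(g)`, i.e. `z|_E = g|_E`.  So `Z` is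
dense, and closed.  (This replaces Chebotarev's theorem — needed for an arbitrary closed `Z` —
by Frobenius' theorem, for sets `Z` stable under powers; the sets
`{σ : charpoly ψ(σ) ∣ charpoly ρ(σ)}` of Böckle–Hui's Prop. 2.4 are of this kind.)
[cite: Marcus2018, Ch. 7, Exercise 12 (f)] [cite: BockleHui2025, Proposition 2.4 (proof)] -/
theorem absoluteGaloisGroup.eq_univ_of_frobenius_mem_of_hasDirichletDensity_one
    {Z : Set (absoluteGaloisGroup K)} (hZc : IsClosed Z)
    (hpow : ∀ σ ∈ Z, ∀ k : ℕ, 0 < k → σ ^ k ∈ Z)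
    {𝓛 : Set (HeightOneSpectrum (𝓞 K))} (h𝓛 : HasDirichletDensity K 𝓛 1)
    (hfrob : ∀ v ∈ 𝓛, ∀ 𝔓 ∈ v.primesAbove, ∀ Φ : absoluteGaloisGroup K,
      IsArithFrobAt (𝓞 K) Φ 𝔓 → Φ ∈ Z) :
    Z = Set.univ := by
  have key : ∀ (g : absoluteGaloisGroup K) (E : IntermediateField K (AlgebraicClosure K)),
      FiniteDimensional K E → Normal K E →
      ∃ z ∈ Z, (absoluteGaloisGroup.toAlgEquiv K g)⁻¹ * absoluteGaloisGroup.toAlgEquiv K z ∈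
        E.fixingSubgroup := by
    intro g E hfin hnorm
    obtain ⟨N, ρ, hρ⟩ := absoluteGaloisGroup.exists_framedArtinRep_restrictNormalHom_eq E
    have hker := ρ.isOpen_ker_toMonoidHom
    -- Frobenius' division theorem along `𝓛` for `ρ` and `g`
    obtain ⟨v, hv𝓛, -, 𝔓, h𝔓, Φ, hΦ, k, hcop, hρΦ⟩ :=
      ρ.exists_mem_frobenius_mem_division_of_hasDirichletDensity_one hker g h𝓛
    have hΦZ : Φ ∈ Z := hfrob v hv𝓛 𝔓 h𝔓 Φ hΦ
    -- a positive power `z = Φ ^ j ∈ Z` with `ρ z = ρ g`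
    obtain ⟨j, hj, hz⟩ : ∃ j : ℕ, 0 < j ∧ ρ (Φ ^ j) = ρ g := by
      have hm0 : 0 < orderOf (ρ g) := (ρ.isOfFinOrder_apply_of_isOpen_ker hker g).orderOf_pos
      rcases Nat.lt_or_ge 1 (orderOf (ρ g)) with hm | hm
      · obtain ⟨j, -, hj⟩ := Nat.exists_mul_mod_eq_one_of_coprime hcop hm
        have hj0 : 0 < j := by
          rcases Nat.eq_zero_or_pos j with rfl | hj0
          · rw [mul_zero, Nat.zero_mod] at hj
            exact absurd hj zero_ne_one
          · exact hj0
        refine ⟨j, hj0, ?_⟩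
        rw [map_pow, hρΦ, ← pow_mul, ← pow_mod_orderOf, hj, pow_one]
      · -- `ρ g = 1`
        have h1 : ρ g = 1 := orderOf_eq_one_iff.mp (le_antisymm hm hm0)
        refine ⟨orderOf (ρ Φ), (ρ.isOfFinOrder_apply_of_isOpen_ker hker Φ).orderOf_pos, ?_⟩
        rw [map_pow, pow_orderOf_eq_one, h1]
    refine ⟨Φ ^ j, hpow Φ hΦZ j hj, ?_⟩
    -- `z|_E = g|_E`
    have heq := hρ (Φ ^ j) g hz
    rw [IntermediateField.mem_fixingSubgroup_iff]
    intro x hx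
    have h1 := AlgEquiv.restrictNormalHom_apply E (absoluteGaloisGroup.toAlgEquiv K (Φ ^ j)) ⟨x, hx⟩
    have h2 := AlgEquiv.restrictNormalHom_apply E (absoluteGaloisGroup.toAlgEquiv K g) ⟨x, hx⟩
    rw [heq] at h1
    have h12 : absoluteGaloisGroup.toAlgEquiv K (Φ ^ j) x = absoluteGaloisGroup.toAlgEquiv K g x :=
      h1.symm.trans h2
    rw [AlgEquiv.mul_apply, AlgEquiv.aut_inv, AlgEquiv.symm_apply_eq]
    exact h12
  have hdense : Dense Z :=
    AlgEquiv.dense_of_forall_exists_mem_fixingSubgroup (K := K) (L := AlgebraicClosure K)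
      fun g E hfin hnorm => key g E hfin hnorm
  have h := hdense.closure_eq
  rwa [hZc.closure_eq] at h

/-- **A continuous homomorphism of `Γ_K` into a `T₁` topological group which kills every
arithmetic Frobenius over a set of places of Dirichlet density one is trivial**: its kernel is a
closed subgroup (so stable under powers) containing those Frobenii, hence all of `Γ_K`
(`absoluteGaloisGroup.eq_univ_of_frobenius_mem_of_hasDirichletDensity_one`).  For a character of
finite order this is Böckle–Hui's use of Chebotarev in Lemma 2.8 (iv) ("`δ(S_{𝟙∣ν_{G_ρ}}) = 1` and
thus `𝟙 = ν_{G_ρ}`") and in the proof of Prop. 2.9; here it follows from Frobenius' theorem.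
[cite: BockleHui2025, Lemma 2.8 (iv) (proof)] -/
theorem MonoidHom.eq_one_of_frobenius_eq_one_of_hasDirichletDensity_one {G : Type*} [Group G]
    [TopologicalSpace G] [T1Space G] (f : absoluteGaloisGroup K →* G) (hf : Continuous f)
    {𝓛 : Set (HeightOneSpectrum (𝓞 K))} (h𝓛 : HasDirichletDensity K 𝓛 1)
    (hfrob : ∀ v ∈ 𝓛, ∀ 𝔓 ∈ v.primesAbove, ∀ Φ : absoluteGaloisGroup K,
      IsArithFrobAt (𝓞 K) Φ 𝔓 → f Φ = 1) :
    f = 1 := by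
  have hZc : IsClosed ((f.ker : Subgroup (absoluteGaloisGroup K)) : Set (absoluteGaloisGroup K)) := by
    have h : ((f.ker : Subgroup (absoluteGaloisGroup K)) : Set (absoluteGaloisGroup K)) = f ⁻¹' {1} := by
      ext σ
      simp [MonoidHom.mem_ker]
    rw [h]
    exact isClosed_singleton.preimage hf
  have hZ := absoluteGaloisGroup.eq_univ_of_frobenius_mem_of_hasDirichletDensity_one hZc
    (fun σ hσ k _ => f.ker.pow_mem hσ k) h𝓛
    (fun v hv 𝔓 h𝔓 Φ hΦ => (MonoidHom.mem_ker).mpr (hfrob v hv 𝔓 h𝔓 Φ hΦ))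
  ext σ
  have hσ : σ ∈ ((f.ker : Subgroup (absoluteGaloisGroup K)) : Set (absoluteGaloisGroup K)) := by
    rw [hZ]; exact Set.mem_univ σ
  exact (MonoidHom.mem_ker).mp hσ

/-- **Rigidity along a density-one set.**  Two continuous representations
`ρ₁, ρ₂ : Γ_K →ₜ* GL_n(A)` (`A` a Hausdorff topological ring) which agree at every arithmetic
Frobenius element over every place of a set of Dirichlet density one are equal: the coincidence
set `{σ : ρ₁ σ = ρ₂ σ}` is closed, stable under powers and contains those Frobenii
(`absoluteGaloisGroup.eq_univ_of_frobenius_mem_of_hasDirichletDensity_one`).  For characters this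
is the uniqueness half of Böckle–Hui's Prop. 2.9 ("we must have `ψ_i = ξ_a`") and shows that the
weak abelian direct summand `ψ` of Thm. 1.1 is determined by its Frobenius values on the density-one
set `𝓛` of Def. 2.3 (Galois-side companion of `HeckeCharacter.eq_of_hasFrobCharpolyAt_eventually`).
[cite: BockleHui2025, Proposition 2.9 (proof)] -/
theorem FramedGaloisRep.eq_of_frobenius_eq_of_hasDirichletDensity_one {A : Type*} [CommRing A]
    [TopologicalSpace A] [T2Space A] {n : ℕ} (ρ₁ ρ₂ : FramedGaloisRep K A n)
    {𝓛 : Set (HeightOneSpectrum (𝓞 K))} (h𝓛 : HasDirichletDensity K 𝓛 1)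
    (hfrob : ∀ v ∈ 𝓛, ∀ 𝔓 ∈ v.primesAbove, ∀ Φ : absoluteGaloisGroup K,
      IsArithFrobAt (𝓞 K) Φ 𝔓 → ρ₁ Φ = ρ₂ Φ) :
    ρ₁ = ρ₂ := by
  set Z : Set (absoluteGaloisGroup K) := {σ | ρ₁ σ = ρ₂ σ} with hZdef
  have hZc : IsClosed Z := isClosed_eq ρ₁.continuous ρ₂.continuous
  have hpow : ∀ σ ∈ Z, ∀ k : ℕ, 0 < k → σ ^ k ∈ Z := fun σ hσ k _ => by
    change ρ₁ (σ ^ k) = ρ₂ (σ ^ k)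
    rw [map_pow, map_pow, show ρ₁ σ = ρ₂ σ from hσ]
  have hZ := absoluteGaloisGroup.eq_univ_of_frobenius_mem_of_hasDirichletDensity_one hZc hpow h𝓛
    (fun v hv 𝔓 h𝔓 Φ hΦ => hfrob v hv 𝔓 h𝔓 Φ hΦ)
  refine ContinuousMonoidHom.ext fun σ => ?_
  have hσ : σ ∈ Z := by rw [hZ]; exact Set.mem_univ σ
  exact hσ

end Criterion

end Literature.NumberTheory.GaloisRepresentations
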